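import Literature.Probability.LatticeModels.LeeYangFirstZeroMonotoneProofs
import Literature.Probability.LatticeModels.UrsellMonotonicityProofs
import HarnessLib

/-!
# Camia–Jiang–Newman 2023, Theorem 2 from a pinned-sign inequality at the first Lee–Yang zero

Topic `Literature/Probability/LatticeModels`; sibling PROOF file of `UrsellMonotonicity.lean`, which
vendors F. Camia, J. Jiang, C. M. Newman, *Monotonicity of Ursell functions in the Ising model*,
Comm. Math. Phys. 401 (2023) [CamiaJiangNewman2023] as the named facts `CamiaJiangNewman2023_thm1`
and `CamiaJiangNewman2023_thm2` (Thm 2 = the Nishimori–Griffiths conjecture: the first Lee–Yang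
zero of `h ↦ ⟨exp[h ∑ λ_u σ_u]⟩_{G,J}` is antitone in the ferromagnetic couplings `J`).

The printed proof of Thm 2 goes through Thm 1 (formalised in the tree as
`CamiaJiangNewman2023_thm2_of_thm1`, `UrsellFirstZeroProofs.lean`).  This file proves a DIFFERENT,
elementary reduction of Thm 2, to a pointwise inequality at the first zero of ONE model:

* `CamiaJiangNewman2023_thm2_of_pinnedSign` — **Thm 2 follows from**: for every finite
  ferromagnetic pair-interaction model `c ≥ 0`, weights `λ ≥ 0`, sites `u ≠ v`, if `θ > 0` is the
  first zero of `θ ↦ ⟨cos θX⟩_c` (`X = ∑ λ_a σ_a`; i.e. `⟨cos θ'X⟩_c > 0` on `[0, θ)` and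
  `⟨cos θX⟩_c = 0`), then `⟨σ_u σ_v cos θX⟩_c ≤ 0`.

The hypothesis is the `J_{uv}`-derivative of `⟨cos θX⟩` at the first zero (Nishimori–Griffiths
1983 discuss the motion of the zeros in one coupling; Hou–Jiang–Newman 2023, Lemma 3, is the
identity behind the argument below); it is NOT proved here and NOT asserted as a fact — it enters
as an explicit hypothesis, exactly like Thm 1 in `CamiaJiangNewman2023_thm2_of_thm1`.

The argument (not in CJN; recorded in the seat's evidence file `thm2_direct_route.md`):
raising the coupling of the ordered pair `(u,v)` by `δ ≥ 0` multiplies the Boltzmann weight by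
`e^{δ σ_uσ_v} = cosh δ + σ_uσ_v sinh δ` (`weight_setCoupling_add`, `exp_mul_spin`), so at the first
zero `θ⋆` of `⟨cos θX⟩_c` the new numerator is
`cosh δ · Z⟨cos θ⋆X⟩_c + sinh δ · Z⟨σ_uσ_v cos θ⋆X⟩_c = sinh δ · Z⟨σ_uσ_v cos θ⋆X⟩_c ≤ 0`
(`sum_cos_weight_setCoupling`), while it is `> 0` at `θ = 0`; the intermediate value theorem gives
a zero `θ'' ∈ (0, θ⋆]` of `⟨cos θX⟩_{c'}` (`exists_zero_le_of_raise`).  The first zero `θ⋆ ≤ θ` below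
any zero `θ` exists by compactness (`exists_firstZero_le`).  Zeros `h` of the mgf are `± iθ` with
`⟨cos θX⟩ = 0`, `θ ≤ ‖h‖` (generalised Lee–Yang, tree: `PairIsing.exists_cos_zero_of_mgf_eq_zero`),
and `⟨cos θ''X⟩_{c'} = 0` is the zero `iθ''` of the `c'`-mgf (`PairIsing.mgf_mul_I`).  Diagonal
entries do not change averages; a general `c ≤ c'` is reached one entry at a time
(`exists_zero_le_of_le`), as in `ursell_mono_of_thm1`.

No definitions, no named facts.

## References

* [CamiaJiangNewman2023] F. Camia, J. Jiang, C. M. Newman, CMP 401 (2023) 2459–2482,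
  arXiv:2207.12247: Thm 2 and §1.2.
* Q. Hou, J. Jiang, C. M. Newman, *Motion of Lee–Yang zeros*, J. Stat. Phys. 190 (2023),
  arXiv:2208.00917: Lemma 3 (`Z_{t-δ} = cosh δ · Z_t − sinh δ · ∂_t Z_t`) and Remark 2.
* H. Nishimori, R. B. Griffiths, J. Math. Phys. 24 (1983) 2637–2647, §IV (motion of zeros in one
  coupling; Conjecture on the first zero).
-/

noncomputable section

open Finset Complex

namespace Literature.Probability.LatticeModels

namespace PairIsing

variable {ι : Type*} [Fintype ι] [DecidableEq ι]

/-! ### Raising one coupling multiplies the weight by `e^{δ σ_u σ_v}` -/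

omit [Fintype ι] in
/-- `setCoupling c u v (c u v + δ)` adds `δ` to the `(u,v)` entry and nothing else. [folklore] -/
theorem setCoupling_add_apply (c : ι → ι → ℝ) (u v : ι) (δ : ℝ) (a b : ι) :
    setCoupling c u v (c u v + δ) a b = c a b + if a = u ∧ b = v then δ else 0 := by
  unfold setCoupling
  split_ifs with h
  · rw [h.1, h.2]
  · rw [add_zero]

/-- Raising the `(u,v)` coupling by `δ` multiplies every Boltzmann weight by `exp(δ σ_u σ_v)`.
[folklore] -/
theorem weight_setCoupling_add (c : ι → ι → ℝ) (u v : ι) (δ : ℝ) (ρ : SpinConfig ι) :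
    weight (setCoupling c u v (c u v + δ)) ρ =
      weight c ρ * Real.exp (δ * (spinAt u ρ * spinAt v ρ)) := by
  unfold weight
  rw [← Real.exp_add]
  congr 1
  simp_rw [setCoupling_add_apply, add_mul, sum_add_distrib]
  congr 1
  simp_rw [ite_mul, zero_mul]
  rw [Finset.sum_eq_single u, Finset.sum_eq_single v]
  · simp
  · intro b _ hb; simp [hb]
  · intro h; exact absurd (mem_univ v) h
  · intro a _ ha
    exact Finset.sum_eq_zero fun b _ => by simp [ha]
  · intro h; exact absurd (mem_univ u) h

omit [Fintype ι] [DecidableEq ι] in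
/-- `e^{δ s} = cosh δ + s · sinh δ` for a spin value `s = σ_u σ_v ∈ {±1}`. [folklore] -/
theorem exp_mul_spin (δ : ℝ) (u v : ι) (ρ : SpinConfig ι) :
    Real.exp (δ * (spinAt u ρ * spinAt v ρ)) =
      Real.cosh δ + spinAt u ρ * spinAt v ρ * Real.sinh δ := by
  have hs : spinAt u ρ * spinAt v ρ = 1 ∨ spinAt u ρ * spinAt v ρ = -1 := by
    rcases spinAt_eq_one_or_eq_neg_one u ρ with hu | hu <;>
      rcases spinAt_eq_one_or_eq_neg_one v ρ with hv | hv <;> simp [hu, hv]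
  rcases hs with h | h
  · rw [h, mul_one, one_mul, Real.cosh_eq, Real.sinh_eq]; ring
  · rw [h, mul_neg, mul_one, neg_one_mul, Real.cosh_eq, Real.sinh_eq]; ring

/-- The numerator of `⟨cos θX⟩` after raising the `(u,v)` coupling by `δ`:
`Σ cos(θX) w_{c'} = cosh δ · Σ cos(θX) w_c + sinh δ · Σ σ_uσ_v cos(θX) w_c`
(Hou–Jiang–Newman 2023, Lemma 3, at imaginary field). [cite: HouJiangNewman2023, Lemma 3] -/
theorem sum_cos_weight_setCoupling (c : ι → ι → ℝ) (lam : ι → ℝ) (u v : ι) (δ θ : ℝ) :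
    (∑ ρ : SpinConfig ι, Real.cos (θ * weightedMagnetization lam ρ) *
        weight (setCoupling c u v (c u v + δ)) ρ) =
      Real.cosh δ * ∑ ρ : SpinConfig ι, Real.cos (θ * weightedMagnetization lam ρ) * weight c ρ +
        Real.sinh δ * ∑ ρ : SpinConfig ι,
          spinAt u ρ * spinAt v ρ * Real.cos (θ * weightedMagnetization lam ρ) * weight c ρ := by
  simp_rw [weight_setCoupling_add, exp_mul_spin, mul_sum, ← sum_add_distrib]
  refine sum_congr rfl fun ρ _ => ?_
  ring

/-! ### Continuity and the first zero of `θ ↦ ⟨cos θX⟩_c` -/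

/-- `θ ↦ ⟨cos θX⟩_c` is continuous. [folklore] -/
theorem continuous_avg_cos (c : ι → ι → ℝ) (lam : ι → ℝ) :
    Continuous fun θ : ℝ => avg c (fun ρ => Real.cos (θ * weightedMagnetization lam ρ)) := by
  unfold avg
  refine Continuous.div_const (continuous_finsetSum _ fun ρ _ => ?_) _
  exact (Real.continuous_cos.comp (continuous_id.mul continuous_const)).mul continuous_const

/-- `⟨cos 0·X⟩_c = 1`. [folklore] -/
theorem avg_cos_zero (c : ι → ι → ℝ) (lam : ι → ℝ) :
    avg c (fun ρ => Real.cos (0 * weightedMagnetization lam ρ)) = 1 := by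
  simp only [zero_mul, Real.cos_zero]
  exact avg_const c 1

/-- **The first zero.** If `⟨cos θX⟩_c` vanishes at some `θ ≥ 0`, it has a least non-negative zero
`θ⋆ ≤ θ`: `θ⋆ > 0`, `⟨cos θ⋆X⟩_c = 0` and `⟨cos θ'X⟩_c > 0` on `[0, θ⋆)` (closedness of the zero set
and the intermediate value theorem). [folklore] -/
theorem exists_firstZero_le (c : ι → ι → ℝ) (lam : ι → ℝ) {θ : ℝ} (hθ : 0 ≤ θ)
    (hz : avg c (fun ρ => Real.cos (θ * weightedMagnetization lam ρ)) = 0) :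
    ∃ θs : ℝ, 0 < θs ∧ θs ≤ θ ∧
      avg c (fun ρ => Real.cos (θs * weightedMagnetization lam ρ)) = 0 ∧
      ∀ θ' ∈ Set.Ico (0 : ℝ) θs,
        0 < avg c (fun ρ => Real.cos (θ' * weightedMagnetization lam ρ)) := by
  set f : ℝ → ℝ := fun θ' => avg c (fun ρ => Real.cos (θ' * weightedMagnetization lam ρ)) with hf
  have hcont : Continuous f := continuous_avg_cos c lam
  have hf0 : f 0 = 1 := avg_cos_zero c lam
  set T : Set ℝ := Set.Icc 0 θ ∩ f ⁻¹' {0} with hT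
  have hTclosed : IsClosed T := isClosed_Icc.inter (isClosed_singleton.preimage hcont)
  have hθT : θ ∈ T := ⟨⟨hθ, le_rfl⟩, hz⟩
  have hTne : T.Nonempty := ⟨θ, hθT⟩
  have hTbdd : BddBelow T := ⟨0, fun x hx => hx.1.1⟩
  set θs := sInf T with hθs
  have hmem : θs ∈ T := hTclosed.csInf_mem hTne hTbdd
  have hle : θs ≤ θ := csInf_le hTbdd hθT
  have hzero : f θs = 0 := hmem.2
  have hnonneg : 0 ≤ θs := hmem.1.1
  have hpos : 0 < θs := by
    rcases hnonneg.lt_or_eq with h | h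
    · exact h
    · exfalso
      rw [← h, hf0] at hzero
      exact one_ne_zero hzero
  refine ⟨θs, hpos, hle, hzero, fun θ' hθ' => ?_⟩
  -- no zero in `[0, θ')` … `[0, θ']`, hence positive by the IVT
  have hnoZero : ∀ x ∈ Set.Icc (0 : ℝ) θ', f x ≠ 0 := by
    intro x hx hx0
    have hxT : x ∈ T := ⟨⟨hx.1, hx.2.trans (hθ'.2.le.trans hle)⟩, hx0⟩
    have := csInf_le hTbdd hxT
    linarith [hx.2, hθ'.2]
  by_contra hneg
  push Not at hneg
  -- `f 0 = 1 > 0 ≥ f θ'`: a zero in `[0, θ']`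
  have hivt : (0 : ℝ) ∈ f '' Set.Icc 0 θ' := by
    have hsub := intermediate_value_Icc' hθ'.1 hcont.continuousOn
    exact hsub ⟨hneg, by rw [hf0]; exact zero_le_one⟩
  obtain ⟨x, hx, hx0⟩ := hivt
  exact hnoZero x hx hx0

/-! ### Diagonal entries are inert -/

/-- Raising a DIAGONAL entry rescales all weights by `e^δ` and leaves the mgf unchanged.
[folklore] -/
theorem mgf_setCoupling_add_diag (c : ι → ι → ℝ) (lam : ι → ℝ) (u : ι) (δ : ℝ) (h : ℂ) :
    mgf (setCoupling c u u (c u u + δ)) lam h = mgf c lam h := by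
  have hw : ∀ ρ : SpinConfig ι,
      weight (setCoupling c u u (c u u + δ)) ρ = Real.exp δ * weight c ρ := by
    intro ρ
    rw [weight_setCoupling_add, spinAt_mul_self, mul_one, mul_comm]
  unfold mgf
  have hnum : (∑ ρ : SpinConfig ι, exp (h * (weightedMagnetization lam ρ : ℂ)) *
      ((weight (setCoupling c u u (c u u + δ)) ρ : ℝ) : ℂ)) =
      ((Real.exp δ : ℝ) : ℂ) * ∑ ρ : SpinConfig ι, exp (h * (weightedMagnetization lam ρ : ℂ)) *
        (weight c ρ : ℂ) := by
    rw [mul_sum]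
    refine sum_congr rfl fun ρ _ => ?_
    rw [hw, Complex.ofReal_mul]
    ring
  have hden : ((∑ ρ : SpinConfig ι, weight (setCoupling c u u (c u u + δ)) ρ : ℝ) : ℂ) =
      ((Real.exp δ : ℝ) : ℂ) * ((∑ ρ : SpinConfig ι, weight c ρ : ℝ) : ℂ) := by
    rw [← Complex.ofReal_mul, mul_sum]
    exact congrArg _ (sum_congr rfl fun ρ _ => hw ρ)
  rw [hnum, hden]
  exact mul_div_mul_left _ _ (ofReal_ne_zero.2 (Real.exp_pos δ).ne')

end PairIsing

/-! ### One entry at a time (index types in `Type`, as in the named fact) -/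

namespace PairIsing

variable {ι : Type} [Fintype ι] [DecidableEq ι]


/-- **The single-coupling step.** Assume the pinned-sign inequality at first zeros (hypothesis
`hNG`). If `c ≥ 0`, `λ ≥ 0`, `u ≠ v`, `δ ≥ 0` and `h` is a zero of the `c`-mgf, then the mgf of
`c + δ·𝟙_{(u,v)}` has a zero `h'` with `‖h'‖ ≤ ‖h‖`: at the first zero `θ⋆ ≤ ‖h‖` of `⟨cos θX⟩_c`
the new average is `sinh δ · ⟨σ_uσ_v cos θ⋆X⟩_c · Z_c/Z_{c'} ≤ 0`, and it is `1` at `θ = 0`.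
[cite: CamiaJiangNewman2023, Thm 2] [cite: HouJiangNewman2023, Lemma 3] -/
theorem exists_zero_le_of_raise
    (hNG : ∀ (ι : Type) [Fintype ι] [DecidableEq ι] (c : ι → ι → ℝ) (lam : ι → ℝ) (u v : ι)
      (θ : ℝ), (∀ a b, 0 ≤ c a b) → (∀ a, 0 ≤ lam a) → u ≠ v → 0 < θ →
      (∀ θ' ∈ Set.Ico (0 : ℝ) θ,
        0 < PairIsing.avg c (fun ρ => Real.cos (θ' * PairIsing.weightedMagnetization lam ρ))) →
      PairIsing.avg c (fun ρ => Real.cos (θ * PairIsing.weightedMagnetization lam ρ)) = 0 →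
      PairIsing.avg c (fun ρ => spinAt u ρ * spinAt v ρ *
        Real.cos (θ * PairIsing.weightedMagnetization lam ρ)) ≤ 0)
    {c : ι → ι → ℝ} (hc : ∀ a b, 0 ≤ c a b)
    {lam : ι → ℝ} (hlam : ∀ a, 0 ≤ lam a) {u v : ι} (huv : u ≠ v) {δ : ℝ} (hδ : 0 ≤ δ)
    {h : ℂ} (hz : mgf c lam h = 0) :
    ∃ h' : ℂ, mgf (setCoupling c u v (c u v + δ)) lam h' = 0 ∧ ‖h'‖ ≤ ‖h‖ := by
  -- a real zero `θ ≤ ‖h‖` of `⟨cos θX⟩_c`, then the first one `θs ≤ θ`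
  obtain ⟨θ, hθpos, hθle, hθz⟩ := PairIsing.exists_cos_zero_of_mgf_eq_zero hc hlam hz
  obtain ⟨θs, hθs, hθsle, hzs, hposb⟩ := exists_firstZero_le c lam hθpos.le hθz
  -- the pinned-sign inequality at `θs`
  have hN := hNG ι c lam u v θs hc hlam huv hθs hposb hzs
  set c' := setCoupling c u v (c u v + δ) with hc'
  set g : ℝ → ℝ := fun θ' => avg c' (fun ρ => Real.cos (θ' * weightedMagnetization lam ρ))
    with hg
  have hZ : 0 < ∑ ρ : SpinConfig ι, weight c ρ := sum_weight_pos c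
  have hZ' : 0 < ∑ ρ : SpinConfig ι, weight c' ρ := sum_weight_pos c'
  have hnum0 : (∑ ρ : SpinConfig ι,
      Real.cos (θs * weightedMagnetization lam ρ) * weight c ρ) = 0 := by
    have h0 := hzs
    rw [avg_def, div_eq_zero_iff] at h0
    exact h0.resolve_right hZ.ne'
  have hnumN : (∑ ρ : SpinConfig ι,
      spinAt u ρ * spinAt v ρ * Real.cos (θs * weightedMagnetization lam ρ) * weight c ρ) ≤ 0 := by
    have h1 := hN
    rw [avg_def, div_le_iff₀ hZ, zero_mul] at h1
    exact h1
  have hgθs : g θs ≤ 0 := by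
    show avg c' (fun ρ => Real.cos (θs * weightedMagnetization lam ρ)) ≤ 0
    rw [avg_def, hc', sum_cos_weight_setCoupling, hnum0, mul_zero, zero_add]
    refine div_nonpos_iff.2 (Or.inr ⟨?_, (sum_weight_pos _).le⟩)
    exact mul_nonpos_of_nonneg_of_nonpos (Real.sinh_nonneg_iff.2 hδ) hnumN
  have hg0 : g 0 = 1 := avg_cos_zero c' lam
  have hcont : Continuous g := continuous_avg_cos c' lam
  -- IVT on `[0, θs]`
  have hivt : (0 : ℝ) ∈ g '' Set.Icc 0 θs := by
    have hsub := intermediate_value_Icc' hθs.le hcont.continuousOn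
    exact hsub ⟨hgθs, by rw [hg0]; exact zero_le_one⟩
  obtain ⟨θ'', hθ'', hgz⟩ := hivt
  refine ⟨(θ'' : ℂ) * I, ?_, ?_⟩
  · rw [mgf_mul_I]
    exact_mod_cast hgz
  · rw [norm_mul, norm_I, mul_one, norm_real, Real.norm_eq_abs, abs_of_nonneg hθ''.1]
    exact hθ''.2.trans (hθsle.trans hθle)

/-- **All entries** (the single-coupling step iterated over the entries of `ι × ι`; diagonal
entries are inert): for `0 ≤ c ≤ c'` entrywise and `λ ≥ 0`, below every zero of the `c`-mgf there
is a zero of the `c'`-mgf. [cite: CamiaJiangNewman2023, Thm 2] -/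
theorem exists_zero_le_of_le
    (hNG : ∀ (ι : Type) [Fintype ι] [DecidableEq ι] (c : ι → ι → ℝ) (lam : ι → ℝ) (u v : ι)
      (θ : ℝ), (∀ a b, 0 ≤ c a b) → (∀ a, 0 ≤ lam a) → u ≠ v → 0 < θ →
      (∀ θ' ∈ Set.Ico (0 : ℝ) θ,
        0 < PairIsing.avg c (fun ρ => Real.cos (θ' * PairIsing.weightedMagnetization lam ρ))) →
      PairIsing.avg c (fun ρ => Real.cos (θ * PairIsing.weightedMagnetization lam ρ)) = 0 →
      PairIsing.avg c (fun ρ => spinAt u ρ * spinAt v ρ *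
        Real.cos (θ * PairIsing.weightedMagnetization lam ρ)) ≤ 0)
    {c c' : ι → ι → ℝ} (hc : ∀ a b, 0 ≤ c a b)
    (hcc' : ∀ a b, c a b ≤ c' a b) {lam : ι → ℝ} (hlam : ∀ a, 0 ≤ lam a)
    {h : ℂ} (hz : mgf c lam h = 0) :
    ∃ h' : ℂ, mgf c' lam h' = 0 ∧ ‖h'‖ ≤ ‖h‖ := by
  -- interpolate through the matrices `mix S = [c' on S, c off S]`, `S ⊆ ι × ι`
  suffices H : ∀ S : Finset (ι × ι), ∃ h' : ℂ,
      mgf (fun a b => if (a, b) ∈ S then c' a b else c a b) lam h' = 0 ∧ ‖h'‖ ≤ ‖h‖ by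
    simpa using H Finset.univ
  intro S
  induction S using Finset.induction_on with
  | empty => exact ⟨h, by simpa using hz, le_rfl⟩
  | insert p S hp ih =>
    obtain ⟨h₁, hz₁, hle₁⟩ := ih
    set d : ι → ι → ℝ := fun a b => if (a, b) ∈ S then c' a b else c a b with hd
    have hd0 : ∀ a b, 0 ≤ d a b := fun a b => by
      simp only [hd]; split_ifs; exacts [(hc a b).trans (hcc' a b), hc a b]
    have hdp : d p.1 p.2 = c p.1 p.2 := by
      simp only [hd]
      rw [if_neg]
      simpa using hp
    have hstep : (fun a b => if (a, b) ∈ insert p S then c' a b else c a b) =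
        setCoupling d p.1 p.2 (d p.1 p.2 + (c' p.1 p.2 - c p.1 p.2)) := by
      funext a b
      simp only [hd, setCoupling, Finset.mem_insert]
      by_cases hab : a = p.1 ∧ b = p.2
      · obtain ⟨rfl, rfl⟩ := hab
        have hpS : (p.1, p.2) ∉ S := by simpa using hp
        simp [hpS]
      · have hne : (a, b) ≠ p := fun h => hab ⟨by rw [← h], by rw [← h]⟩
        simp [hab, hne]
    rw [hstep]
    by_cases hdiag : p.1 = p.2
    · -- diagonal entry: the mgf does not change
      refine ⟨h₁, ?_, hle₁⟩
      have key := mgf_setCoupling_add_diag d lam p.1 (c' p.1 p.2 - c p.1 p.2) h₁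
      rw [← hdiag] at key ⊢
      rw [key]
      exact hz₁
    · obtain ⟨h₂, hz₂, hle₂⟩ := exists_zero_le_of_raise hNG hd0 hlam hdiag
        (sub_nonneg.2 (hcc' p.1 p.2)) hz₁
      exact ⟨h₂, hz₂, hle₂.trans hle₁⟩

end PairIsing

/-! ### The reduction -/

/-- **Camia–Jiang–Newman 2023, Theorem 2, from the pinned-sign inequality at the first zero.**
If for every finite ferromagnetic pair-interaction model `c ≥ 0`, weights `λ ≥ 0` and sites
`u ≠ v`, at the first zero `θ` of `θ ↦ ⟨cos θX⟩_c` one has `⟨σ_uσ_v cos θX⟩_c ≤ 0`, then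
CJN Thm 2 (zero form, `CamiaJiangNewman2023_thm2`) holds: for `0 ≤ c ≤ c'` and `λ ≥ 0` every zero of
the `c`-mgf has a zero of the `c'`-mgf of no larger modulus.  (The hypothesis is not proved here.)
[cite: CamiaJiangNewman2023, Thm 2] [cite: HouJiangNewman2023, Lemma 3 and Remark 2] -/
theorem CamiaJiangNewman2023_thm2_of_pinnedSign
    (hNG : ∀ (ι : Type) [Fintype ι] [DecidableEq ι] (c : ι → ι → ℝ) (lam : ι → ℝ) (u v : ι)
      (θ : ℝ), (∀ a b, 0 ≤ c a b) → (∀ a, 0 ≤ lam a) → u ≠ v → 0 < θ →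
      (∀ θ' ∈ Set.Ico (0 : ℝ) θ,
        0 < PairIsing.avg c (fun ρ => Real.cos (θ' * PairIsing.weightedMagnetization lam ρ))) →
      PairIsing.avg c (fun ρ => Real.cos (θ * PairIsing.weightedMagnetization lam ρ)) = 0 →
      PairIsing.avg c (fun ρ => spinAt u ρ * spinAt v ρ *
        Real.cos (θ * PairIsing.weightedMagnetization lam ρ)) ≤ 0) :
    CamiaJiangNewman2023_thm2 := by
  intro ι _ _ c c' lam hc hcc' hlam h hz
  exact PairIsing.exists_zero_le_of_le hNG hc hcc' hlam hz

end Literature.Probability.LatticeModels
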